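import Summits.MatrixMultiplication.OmegaCensus.STPPVosperTightStructure
import Summits.MatrixMultiplication.OmegaCensus.STPPVosperClash61Tools2

/-!
# ω-census (abelian STPP census): the VOSPER TABLE LAW at `ℤ₆₁` — an N18-tight block plus a window table kills the pattern (kernel, general form)

HONEST FRAMING (pub-omega census; verbatim): lottery ticket; floor = certified bounds/negative ranges.
Census STRUCTURE (seat pub-omega-stpp-1 gen 29, 2026-08-28), family (b2).  A THEOREM FILTER for the ℤ₆₁ front: it turns the per-pattern Vosper clash files
(`STPPVosperClash235244`, `…325244`, `…225332342`) into one statement whose only pattern-specific input is a finite `ℕ`-table decided by `decide +kernel`;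
nothing here is progress on `ω`.

## Statement (`no_isSTPP_of_tight_table`)

Let `(A_k, B_k, C_k)_{k<N}` be an STPP family (CKSU 2005 Def. 5.1, the tree's `IsSTPP`) with non-empty sets in `ℤ₆₁`, and `i` a block with another block present.
Put `a = |Aᵢ|`, `b = |Bᵢ|`, `vol = aᵢbᵢcᵢ`, `z = |Z°| = Σ_{k≠i} a_k c_k`, `L = |Y°| = Σ_{k≠i} b_k c_k`, and suppose `a, b, z, L ≥ 2` and the N18 chain is TIGHT:
`z + b + vol + a + L = 63`.  Let `m = L + a − 1` and `n = vol + m` (so `n + b = 62 − z`).  If the `ℕ`-TABLE for `(n, m, b)` holds — for all `j, t < 61`: the `m`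
positions `(t + j·i′) mod 61` lying in `[0, n)` together with the prefix law `b ∣ pos − #{earlier positions below}` at each of them force `j ∈ {0, 1, 60}` — then
the family does not exist.

## Proof (the scheme of the three clash files, at a general block)

`vosper_structure_of_n18_tight_V`: `Aᵢ` an `a`-, `Y°` an `L`-progression of step `e`; `Bᵢ` a `b`-progression and `V = W ⊔ (Y° − Aᵢ)` a progression of step `e′`,
`Bᵢ + V = H ∖ Z°`.  Counting (`61 − z ≤ b + |V| − 1`, `|Y° − Aᵢ| ≤ m`) gives `|V| = n` and `Y° − Aᵢ` = an `m`-progression of step `e`.  `W = ⋃_{(x,c)∈Aᵢ×Cᵢ}(c − x − Bᵢ)`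
is a disjoint union of `b`-progressions of step `e′` (TPP of block `i`).  Transport `x ↦ e′⁻¹(x − v)`; the prefix law `dvd_card_filter_val_lt` (`n + b ≤ 62`) holds at
the `m` points of the image of `Y° − Aᵢ`; the table (`val_mem_of_nat_table`) gives `e = ±e′`; and the word `(s′ − s) + (t′ − t) + (γ − γ) = 0` at `(i,i,i)` with
`{s, s′} = {α, α + e} ⊆ Aᵢ`, `t = β`, `t′ = β + e′` breaks the TPP of block `i`.

Measured reach (numbers ×1, approximate enumeration, HOME `pub-omega-stpp-1-g29/scan/vosper_scan_61_nb3.json`): of the 22 minimal beating patterns of `ℤ₆₁` with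
`≤ 3` blocks and entries `≤ 8` alive under the python filters N7–N20, ten have a tight reading whose table leaves only `±1`.

References: A. G. Vosper, J. London Math. Soc. 31 (1956); M. B. Nathanson, *Additive Number Theory: Inverse Problems*, GTM 165, Thm 2.7; H. Cohn,
R. Kleinberg, B. Szegedy, C. Umans, FOCS 2005 (arXiv:math/0511460), Def. 5.1.
-/

open Finset
open scoped Pointwise

namespace Summit.MatrixMultiplication.OmegaCensus.CubeNB

open Literature.Computability.AlgebraicComplexity
open Literature.Combinatorics.Additive
open Summit.MatrixMultiplication.OmegaCensus.STPPKneser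

/-- **The Vosper table law at `ℤ₆₁` (kernel, general block).**  See the module docstring.  The table hypothesis is stated for the concrete numbers
`(n, m, b)`; `hm : L + a = m + 1`, `hn : vol + m = n`. [cite: CohnKleinbergSzegedyUmans2005, Def. 5.1] [cite: Vosper1956, main theorem; Nathanson1996, Thm 2.7] -/
theorem no_isSTPP_of_tight_table {N : ℕ} (A B C : Fin N → Finset (ZMod 61)) (hS : IsSTPP A B C)
    (hA : ∀ k, (A k).Nonempty) (hB : ∀ k, (B k).Nonempty) (hC : ∀ k, (C k).Nonempty)
    (i : Fin N) (hI : ((univ : Finset (Fin N)).erase i).Nonempty)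
    {a b vol z L m n : ℕ} (ha : #(A i) = a) (hb : #(B i) = b) (hvol : #(A i) * #(B i) * #(C i) = vol)
    (hz : ∑ k ∈ univ.erase i, #(A k) * #(C k) = z) (hL : ∑ k ∈ univ.erase i, #(B k) * #(C k) = L)
    (h2a : 2 ≤ a) (h2b : 2 ≤ b) (h2z : 2 ≤ z) (h2L : 2 ≤ L) (htight : z + b + vol + a + L = 63)
    (hm : L + a = m + 1) (hn : vol + m = n)
    (htable : ∀ j < 61, ∀ t < 61, (∀ i' < m, (t + j * i') % 61 < n) →
      (∀ k < m, b ∣ (t + j * k) % 61 - #((range m).filter fun i' => (t + j * i') % 61 < (t + j * k) % 61)) →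
      j ∈ ({0, 1, 60} : Finset ℕ)) : False := by
  have h60 : ((60 : ℕ) : ZMod 61) = -1 := by decide
  haveI : Fact (Nat.Prime 61) := ⟨prime_61⟩
  obtain ⟨a', rfl⟩ : ∃ a', a = a' + 1 := ⟨a - 1, by omega⟩
  obtain ⟨b', rfl⟩ : ∃ b', b = b' + 1 := ⟨b - 1, by omega⟩
  -- Step 0: Vosper structure at the tight block
  obtain ⟨⟨e, he, hAap, hYap⟩, ⟨e', he', hBap, -, hVap, -, hEq⟩⟩ := vosper_structure_of_n18_tight_V hS hA hB hC i hI
    (by rw [ha]; omega) (by rw [hb]; omega) (by rw [hL]; exact h2L) (by rw [hz]; exact h2z) (by rw [hz, hL, hvol, ha, hb]; omega)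
  set W := ((A i) ×ˢ ((B i) ×ˢ (C i))).image fun q : ZMod 61 × ZMod 61 × ZMod 61 => (0 : ZMod 61) + q.2.2 - q.1 - q.2.1 with hW
  set Sn := (A i).image (fun x => (0 : ZMod 61) - x) with hSn
  set Yo := DU B C (univ.erase i) with hYo
  have hWcard : #W = vol := by rw [hW, card_image_blockSum hS i 0, hvol]
  have hWV : Disjoint W (Sn + Yo) := disjoint_W_negA_add_DU hS i
  have hYocard : #Yo = L := by rw [hYo, card_DU_BC hS hA, hL]
  obtain ⟨α, hα⟩ := hAap
  obtain ⟨β, hβ⟩ := hBap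
  obtain ⟨y₀, hy⟩ := hYap
  obtain ⟨v, hv⟩ := hVap
  rw [ha] at hα; rw [hb] at hβ; rw [hYocard] at hy
  -- counting: |V| = n and Y° − Aᵢ is an m-progression of step e
  have hSna : Sn = apFinset (0 - α - a' • e) e (a' + 1) := by rw [hSn, hα, image_sub_apFinset]
  have hsubm : Sn + Yo ⊆ apFinset (0 - α - a' • e + y₀) e m := by
    have h := apFinset_add_apFinset_subset (0 - α - a' • e) y₀ e (a' + 1) L
    rw [show a' + 1 + L - 1 = m by omega] at h
    rwa [hSna, hy]
  have hlem : #(Sn + Yo) ≤ m := (Finset.card_le_card hsubm).trans (card_apFinset_le _ _ _)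
  have hZcard : #(DU A C (univ.erase i)) = z := by rw [card_DU_AC hS hB, hz]
  have hU : #(univ \ DU A C ((univ : Finset (Fin N)).erase i)) = 61 - z := by
    rw [Finset.card_sdiff_of_subset (Finset.subset_univ _), Finset.card_univ, ZMod.card, hZcard]
  have hBV : #(B i + (W ∪ (Sn + Yo))) ≤ (b' + 1) + #(W ∪ (Sn + Yo)) - 1 := by
    have h := (Finset.card_le_card (apFinset_add_apFinset_subset β v e' (b' + 1) #(W ∪ (Sn + Yo)))).trans
      (card_apFinset_le _ _ _)
    rwa [← hβ, ← hv] at h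
  rw [hEq, hU] at hBV
  have hVcard : #(W ∪ (Sn + Yo)) = #W + #(Sn + Yo) := Finset.card_union_of_disjoint hWV
  have hSYcard : #(Sn + Yo) = m := by omega
  have hVn : #(W ∪ (Sn + Yo)) = n := by omega
  have hSY : Sn + Yo = apFinset (0 - α - a' • e + y₀) e m :=
    Finset.eq_of_subset_of_card_le hsubm (by rw [hSYcard, card_apFinset he (by omega)])
  rw [hVn] at hv
  rw [hSY] at hWV hv
  -- Step 1: W is the union of the blocks (c − x) − Bᵢ, pairwise disjoint by the TPP of block i
  set P := (A i) ×ˢ (C i) with hP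
  have hblk : ∀ xc : ZMod 61 × ZMod 61,
      (B i).image (fun y => (xc.2 - xc.1) - y) = apFinset (xc.2 - xc.1 - β - b' • e') e' (b' + 1) := by
    intro xc; rw [hβ, image_sub_apFinset]
  have hWeq : W = P.biUnion fun xc => apFinset (xc.2 - xc.1 - β - b' • e') e' (b' + 1) := by
    ext x
    simp only [hW, hP, Finset.mem_image, Finset.mem_product, Finset.mem_biUnion, Prod.exists]
    constructor
    · rintro ⟨x₁, y, c, ⟨hx₁, hy', hc⟩, rfl⟩
      refine ⟨x₁, c, ⟨hx₁, hc⟩, ?_⟩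
      rw [← hblk (x₁, c)]
      exact Finset.mem_image.2 ⟨y, hy', by abel⟩
    · rintro ⟨x₁, c, ⟨hx₁, hc⟩, hx⟩
      rw [← hblk (x₁, c)] at hx
      obtain ⟨y, hy', rfl⟩ := Finset.mem_image.1 hx
      exact ⟨x₁, y, c, ⟨hx₁, hy', hc⟩, by abel⟩
  have hPdisj : (P : Set (ZMod 61 × ZMod 61)).PairwiseDisjoint fun xc => apFinset (xc.2 - xc.1 - β - b' • e') e' (b' + 1) := by
    rintro ⟨x₁, c⟩ hxc ⟨x₁', c'⟩ hxc' hne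
    rw [Function.onFun, ← hblk, ← hblk, Finset.disjoint_left]
    intro x hx hx'
    obtain ⟨y, hy', rfl⟩ := Finset.mem_image.1 hx
    obtain ⟨y', hy'', hyy⟩ := Finset.mem_image.1 hx'
    have h1 := Finset.mem_product.1 (Finset.mem_coe.1 hxc)
    have h2 := Finset.mem_product.1 (Finset.mem_coe.1 hxc')
    have hrel : (x₁' - x₁) + (y' - y) + (c - c') = 0 := by
      have h : c' - x₁' - y' = c - x₁ - y := hyy
      linear_combination (-1 : ZMod 61) * h
    obtain ⟨-, -, h3, -, h5⟩ := hS i i i x₁ h1.1 x₁' h2.1 y hy' y' hy'' c' h2.2 c h1.2 hrel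
    exact hne (Prod.ext h3 h5.symm)
  -- Step 2: transport by φ(x) = u·x + w, u = e′⁻¹, w = −u·v
  obtain ⟨u, hu⟩ : ∃ u : ZMod 61, u = e'⁻¹ := ⟨_, rfl⟩
  have hu0 : u ≠ 0 := by rw [hu]; exact inv_ne_zero he'
  have hue : u * e' = 1 := by rw [hu]; exact inv_mul_cancel₀ he'
  obtain ⟨w, hw⟩ : ∃ w : ZMod 61, w = -(u * v) := ⟨_, rfl⟩
  have hφinj : Function.Injective (fun x : ZMod 61 => u * x + w) := affine_injective hu0 w
  have hφV : (apFinset v e' n).image (fun x => u * x + w) = apFinset 0 1 n := by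
    rw [image_affine_apFinset, hue, hw, add_neg_cancel]
  set g : ZMod 61 × ZMod 61 → ZMod 61 := fun xc => u * (xc.2 - xc.1 - β - b' • e') + w with hg
  have hφblk : ∀ xc : ZMod 61 × ZMod 61,
      (apFinset (xc.2 - xc.1 - β - b' • e') e' (b' + 1)).image (fun x => u * x + w) = apFinset (g xc) 1 (b' + 1) := by
    intro xc; rw [image_affine_apFinset, hue]
  set T := W.image (fun x => u * x + w) with hT
  have hTeq : T = P.biUnion fun xc => apFinset (g xc) 1 (b' + 1) := by
    rw [hT, hWeq, Finset.biUnion_image]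
    exact Finset.biUnion_congr rfl fun xc _ => hφblk xc
  have hTdisj : (P : Set (ZMod 61 × ZMod 61)).PairwiseDisjoint fun xc => apFinset (g xc) 1 (b' + 1) := by
    intro xc hxc xc' hxc' hne
    rw [Function.onFun, ← hφblk, ← hφblk]
    exact (Finset.disjoint_image hφinj).2 (hPdisj hxc hxc' hne)
  set S := (apFinset (0 - α - a' • e + y₀) e m).image (fun x => u * x + w) with hSdef
  have hSeq : S = apFinset (u * (0 - α - a' • e + y₀) + w) (u * e) m := by rw [hSdef, image_affine_apFinset]
  have hTS : T ∪ S = apFinset 0 1 n := by rw [hT, hSdef, ← Finset.image_union, hv, hφV]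
  have hTSdisj : Disjoint T S := by rw [hT, hSdef]; exact (Finset.disjoint_image hφinj).2 hWV
  have hTsub : ∀ xc ∈ P, apFinset (g xc) 1 (b' + 1) ⊆ apFinset 0 1 n := by
    intro xc hxc y hy'
    rw [← hTS, hTeq]
    exact Finset.mem_union_left _ (Finset.mem_biUnion.2 ⟨xc, hxc, hy'⟩)
  have hSsub : S ⊆ apFinset 0 1 n := by rw [← hTS]; exact Finset.subset_union_right
  -- Step 3: prefix law at the points of S, and the table
  have hn61 : n ≤ 61 := by omega
  have hj0 : u * e ≠ 0 := mul_ne_zero hu0 he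
  have hgap : ∀ x ∈ S, (b' + 1) ∣ x.val - #(S.filter fun y => y.val < x.val) := by
    intro x hxS
    have hxT : x ∉ T := fun hxT => Finset.disjoint_left.1 hTSdisj hxT hxS
    have hxle : x.val ≤ n := ((mem_apFinset_zero_one_iff (p := 61) hn61).1 (hSsub hxS)).le
    have h4 : (b' + 1) ∣ #(T.filter fun y => y.val < x.val) := by
      rw [hTeq]
      exact dvd_card_filter_val_lt P g (by omega) hTdisj hTsub x (by rw [← hTeq]; exact hxT)
    rw [(card_filter_val_lt_of_union_window hn61 hTS hTSdisj hxle).2] at h4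
    exact h4
  rw [hSeq] at hgap hSsub
  have hval := val_mem_of_nat_table hn61 (by omega) htable hj0 hSsub hgap
  -- e = ±e′
  have hpm : e = e' ∨ e = -e' := by
    have hee : e' * (u * e) = e := by rw [← mul_assoc, mul_comm e' u, hue, one_mul]
    simp only [Finset.mem_insert, Finset.mem_singleton] at hval
    rcases hval with h0 | h1 | h60'
    · exact absurd ((ZMod.val_eq_zero _).1 h0) hj0
    · left
      have h : ((u * e).val : ZMod 61) = ((1 : ℕ) : ZMod 61) := by rw [h1]
      rw [ZMod.natCast_zmod_val, Nat.cast_one] at h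
      rw [← hee, h, mul_one]
    · right
      have h : ((u * e).val : ZMod 61) = ((60 : ℕ) : ZMod 61) := by rw [h60']
      rw [ZMod.natCast_zmod_val, h60] at h
      rw [← hee, h, mul_neg, mul_one]
  -- Step 4: the TPP of block i fails
  obtain ⟨γ, hγ⟩ := hC i
  have hαmem : α ∈ A i := by rw [hα]; exact mem_apFinset.2 ⟨0, by omega, by simp⟩
  have hαe : α + e ∈ A i := by rw [hα]; exact mem_apFinset.2 ⟨1, by omega, by simp⟩
  have hβmem : β ∈ B i := by rw [hβ]; exact mem_apFinset.2 ⟨0, by omega, by simp⟩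
  have hβe : β + e' ∈ B i := by rw [hβ]; exact mem_apFinset.2 ⟨1, by omega, by simp⟩
  rcases hpm with h | h
  · have hrel : (α - (α + e)) + ((β + e') - β) + (γ - γ) = 0 := by rw [h]; ring
    obtain ⟨-, -, -, h4, -⟩ := hS i i i (α + e) hαe α hαmem β hβmem (β + e') hβe γ hγ γ hγ hrel
    exact he' (by linear_combination h4.symm)
  · have hrel : ((α + e) - α) + ((β + e') - β) + (γ - γ) = 0 := by rw [h]; ring
    obtain ⟨-, -, -, h4, -⟩ := hS i i i α hαmem (α + e) hαe β hβmem (β + e') hβe γ hγ γ hγ hrel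
    exact he' (by linear_combination h4.symm)

end Summit.MatrixMultiplication.OmegaCensus.CubeNB
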